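import Mathlib
import HarnessLib
import Summits.AtomisticToContinuum.FouriersLaw.Theses.DiluteCellGaussianiser
import Summits.AtomisticToContinuum.FouriersLaw.Theorems.FourierGreenKuboFourierFiniteResponseOfUnique

/-!
# Birth skeleton (BC3) for crux `DiluteCellGaussianiser.DensificationClosure`
(item `stmt-AtomisticToContinuum-12894`, route `route-AtomisticToContinuum-DiluteCellGaussianiser`, crux rank 6,
sub-problem `FouriersLaw`; registrar `planner-skel-stmt-AtomisticToContinuum-12894-0`, 2026-08-17)

Crux (FIXED, concluded BY NAME below — THE PLUG-IN / densification): for all `ω₂ lam β γ > 0` and every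
`T > 0`, if the `d`-dilute conjunct chains `C_d = diluteChain ω₂ lam β γ d` obey the pointwise
Bonetto–Lebowitz–Rey-Bellet law at `T` (`SiteChain.FouriersLawAt`) for all `d ≥ d₀`, then the dense chain
`C_1` (`= (pinnedChain ω₂ lam β γ).toSiteChain`, `diluteChain_one`) obeys it at `T`.

## Line `birth` — DENSIFICATION THROUGH THE BOUNDED-RESPONSE WAYPOINT
(comparison of BOUNDS under densification × the vetted residual `BoundedResponseConverges`)

The only thing a comparison principle can be expected to transmit from the sparse chains `C_d` to the
dense chain `C_1` is an a-priori BOUND on the finite-size conductivity `D_N`, not its limit.  So the line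
routes the plug-in through the catalogued waypoint `SiteChain.HasBoundedResponseAt` ("`κ_N` bounded
uniformly in `N`", the fixed-`T` slice of `Literature.Barriers.AtomisticToContinuum.HasBoundedResponse`,
a PROVED necessary condition of the law) and then through the sub-problem's standard residual:

* glue (PROVED here, `hasBoundedResponseAt_of_fouriersLawAt`): the law at `T` for `C_{d₀}` gives bounded
  response at `T` for `C_{d₀}` (limits along `𝓝[≠] 0` are unique; convergent ⇒ bounded) — the `SiteChain`
  version of `Literature.Barriers.AtomisticToContinuum.hasBoundedResponse_of_fouriersLawFor`.
* `stub_densifyBounded` (COMPARISON UNDER DENSIFICATION — the lever, hardest): for every spacing `d`,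
  bounded response of `C_d` at `T` implies bounded response of `C_1` at `T`: switching on the conjunct's
  quartic terms at the remaining sites of `C_d` (cell lattice `dℕ ↦ ℕ`) cannot UNBOUND `κ_N` — resistance
  is monotone non-decreasing in the cell set in the eventual, up-to-constants sense that `BddAbove`
  encodes ("adding cells to an Ohmic chain keeps it at most Ohmic": the comparison principle named in the
  item text, asked only at the level of UPPER BOUNDS on `D_N`, where a Rayleigh/Dirichlet-type monotonicity
  is plausible, and only for the commensurate periodic pair `(C_d, C_1)`).  Docking point for the
  densification cards (even-parity-dirichlet-principle, two-channel-dephasing,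
  bath-renormalisation-parabolic-fixed-point); nearest typed relative: MatthiessenLadder's
  `PrefixIncrementBounds` (stmt-12776, densification along the prefix ladder with two-sided increments).
  Size XL (open: no comparison principle for deterministic coherent transport is in print;
  DharLebowitz2008's counter-intuition concerns LOCALISED disordered hosts, not the periodic `C_d`).
* `stub_boundedResponseConverges` (THE RESIDUAL, an EXISTING vetted item VERBATIM): the shared crux
  `BoundedResponseConverges` — stmt-AtomisticToContinuum-9141 (OddSectorIrreversibility / LocalOhmBV /
  MatthiessenLadder / TransferKernelPositivity; ≡ stmt-2741 of LocalOhmRigidity), byte-identical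
  signature: under weak-NESS uniqueness, along any steady-state family of `pinnedChain ω₂ lam β γ` and
  `T > 0`, bounded response coefficients `D_N` converge to some `k > 0` ("FouriersLawFor minus
  HasBoundedResponse"; live crux chain, registered line `escape-deficit-dichotomy`).  Any landing there
  closes this stub by `exact`.
* COMPOSITION `DensificationClosure_of : stub₁-statement → stub₂-statement → DensificationClosure`
  (sorry-free, ~30 lines over four proved glue lemmas; the crux BY NAME): take `d := d₀`; law ⇒ bounded for `C_{d₀}` (glue) ⇒ bounded
  for `C_1` (stub 1); move to `pinnedChain` by `diluteChain_one` (`Iff.rfl` dictionaries below); weak-NESS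
  uniqueness is LANDED (`NessUnique_holds`, stmt-0741) and so is the existence of the response limits
  along every family (`Theorems.FourierGreenKubo.finiteResponse_of_unique`, stmt-0717); pick one family
  `μ₀` (if none exists the law holds vacuously with `k := 1`), get its `D₀`, bounded by stub 1, convergent to
  `k > 0` by stub 2; every other family has the same response quotients near `δ = 0` (uniqueness at the
  positive temperatures `T ± δ/2`, `Filter.EventuallyEq`), hence the same `D₀`, hence the law at `T` with
  this `k`.  `DensificationClosure_skeleton` instantiates it with the two stubs (its only `sorry`s are theirs).

Hardest stub: `stub_densifyBounded` (it is where the dilute rung enters; no monotonicity of `κ` in the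
scatterer set is known for deterministic chains — the item's why-might-fail).  Why the cut is not a costume:
`stub_densifyBounded` alone yields only `HasBoundedResponseAt` for `C_1` (no convergence, no positivity —
exactly the catalogued gap between the barrier statement and the law); `stub_boundedResponseConverges`
alone has an undischarged hypothesis (bounded response of the anharmonic chain — the open barrier
statement, false at `lam = β = 0` by `HarmonicChainBallisticFlux.not_hasBoundedResponse`) and never
mentions the dilute family; the crux's hypothesis reaches `C_1` only through the bound.  BC3 probes
`stub → DensificationClosure`, `stub → FouriersLaw` by `first | exact? | simpa | aesop` fail for both stubs
(planner folder `bc/`, quoted in NOTES.md and `Lines/birth.md`).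
Disproof used: none on file (`ledger crux ls stmt-AtomisticToContinuum-12894`: no workfiles, no
`Disproof.lean`, no `Negative/` lemma, 2026-08-17); the negatives index (20 entries) has no statement about
cell-set comparison or bounded response ⇒ law; stub 2 is a grounded+checked open item, so every
`_false_without_` obstruction recorded for it (its `Cruxes/BoundedResponseConverges/Disproof.lean`:
uniqueness and the steady family are load-bearing) is honoured verbatim.
-/

noncomputable section

open MeasureTheory Filter Topology

namespace Summit.AtomisticToContinuum.FouriersLaw.Cruxes.DensificationClosure

namespace Birth

open Literature.MathematicalPhysics.KineticTheory.HeatConduction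

/-! ## The two registered stubs (the only `sorry`s of this file) -/

/-- **stub 1 — `stub_densifyBounded` (comparison of bounds under densification of the cell lattice).**
For `ω₂, lam, β, γ > 0`, `T > 0` and every spacing `d`: if the `d`-dilute conjunct chain
`diluteChain ω₂ lam β γ d` has bounded response at `T` (`SiteChain.HasBoundedResponseAt`: along every
family of weak steady states and every sequence of response limits `D_N` at `T`, `(|D_N|)_N` is bounded),
then so does the dense chain `diluteChain ω₂ lam β γ 1` (the conjunct's `pinnedChain` as a site chain).
"Adding the missing cells cannot unbound `κ_N`" — monotonicity of the resistance in the cell set, in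
eventual / up-to-constants form, for the periodic pair `(C_d, C_1)` only.  Open (size XL). -/
theorem stub_densifyBounded :
    ∀ ω₂ lam β γ : ℝ, 0 < ω₂ → 0 < lam → 0 < β → 0 < γ → ∀ T : ℝ, 0 < T → ∀ d : ℕ,
      (Literature.MathematicalPhysics.KineticTheory.HeatConduction.diluteChain ω₂ lam β γ d).HasBoundedResponseAt T →
        (Literature.MathematicalPhysics.KineticTheory.HeatConduction.diluteChain ω₂ lam β γ 1).HasBoundedResponseAt T := by
  sorry

/-- **stub 2 — `stub_boundedResponseConverges` (the residual; VERBATIM the shared vetted item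
`BoundedResponseConverges`, stmt-AtomisticToContinuum-9141 ≡ stmt-2741).**  For `pinnedChain ω₂ lam β γ`
(all `> 0`), under weak-NESS uniqueness, along any steady-state family `μ` and every `T > 0`: if `D_N` are
the response limits and `(|D_N|)_N` is bounded, then `D_N → k` for some `k > 0` ("FouriersLawFor minus
HasBoundedResponse"; expected from FeketeResistance / escape-deficit-dichotomy or FourierGreenKubo's
ThermodynamicLimit).  Open (size L–XL); closing stmt-9141 closes this stub by `exact`. -/
theorem stub_boundedResponseConverges :
    ∀ ω₂ lam β γ : ℝ, 0 < ω₂ → 0 < lam → 0 < β → 0 < γ → (∀ (N : ℕ) (T_L T_R : ℝ), 0 < T_L → 0 < T_R → ∀ μ ν : MeasureTheory.Measure (Literature.MathematicalPhysics.KineticTheory.HeatConduction.PhaseSpace N), (Literature.MathematicalPhysics.KineticTheory.HeatConduction.pinnedChain ω₂ lam β γ).IsSteadyState N T_L T_R μ → (Literature.MathematicalPhysics.KineticTheory.HeatConduction.pinnedChain ω₂ lam β γ).IsSteadyState N T_L T_R ν → μ = ν) → ∀ μ : (N : ℕ) → ℝ → ℝ → MeasureTheory.Measure (Literature.MathematicalPhysics.KineticTheory.HeatConduction.PhaseSpace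 N), (∀ (N : ℕ) (T_L T_R : ℝ), 0 < T_L → 0 < T_R → (Literature.MathematicalPhysics.KineticTheory.HeatConduction.pinnedChain ω₂ lam β γ).IsSteadyState N T_L T_R (μ N T_L T_R)) → ∀ T : ℝ, 0 < T → ∀ D : ℕ → ℝ, (∀ N : ℕ, Filter.Tendsto (fun δ : ℝ => (Literature.MathematicalPhysics.KineticTheory.HeatConduction.pinnedChain ω₂ lam β γ).totalCurrent (μ N (T + δ / 2) (T - δ / 2)) / δ) (nhdsWithin 0 {(0 : ℝ)}ᶜ) (nhds (D N))) → BddAbove (Set.range fun N => |D N|) → ∃ k : ℝ, 0 < k ∧ Filter.Tendsto D Filter.atTop (nhds k) := by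
  sorry

/-! ## Glue (all sorry-free) -/

/-- **Fourier's law at `T` forces bounded response at `T`** for any site chain (the `SiteChain` /
fixed-`T` version of `Literature.Barriers.AtomisticToContinuum.hasBoundedResponse_of_fouriersLawFor`):
given a steady-state family and response limits `D N`, clause (ii) provides `D' N` with the same limits and
`D' → k`; limits along the proper filter `𝓝[≠] 0` are unique, so `D = D'` converges, hence `|D|` is
bounded. -/
theorem hasBoundedResponseAt_of_fouriersLawAt {P : SiteChain} {T : ℝ} (h : P.FouriersLawAt T) :
    P.HasBoundedResponseAt T := by
  intro μ hμ D hD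
  obtain ⟨k, -, hall⟩ := h
  obtain ⟨D', hD', hlim⟩ := hall μ hμ
  have hDD : D = D' := funext fun N => tendsto_nhds_unique (hD N) (hD' N)
  subst hDD
  exact ((continuous_abs.tendsto _).comp hlim).bddAbove_range

/-- Dictionary: the pointwise law for a homogeneous chain viewed as a site chain, unfolded to
`OscillatorChain` vocabulary (`toSiteChain_isSteadyState`, `toSiteChain_totalCurrent` are `rfl`). -/
theorem toSiteChain_fouriersLawAt_iff (P : OscillatorChain) (T : ℝ) :
    P.toSiteChain.FouriersLawAt T ↔
      ∃ k : ℝ, 0 < k ∧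
        ∀ μ : (N : ℕ) → ℝ → ℝ → Measure (PhaseSpace N),
          (∀ (N : ℕ) (T_L T_R : ℝ), 0 < T_L → 0 < T_R → P.IsSteadyState N T_L T_R (μ N T_L T_R)) →
            ∃ D : ℕ → ℝ,
              (∀ N : ℕ, Tendsto (fun δ : ℝ => P.totalCurrent (μ N (T + δ / 2) (T - δ / 2)) / δ)
                (𝓝[≠] 0) (𝓝 (D N))) ∧
              Tendsto D atTop (𝓝 k) :=
  Iff.rfl

/-- Dictionary: bounded response at `T` for a homogeneous chain viewed as a site chain, unfolded. -/
theorem toSiteChain_hasBoundedResponseAt_iff (P : OscillatorChain) (T : ℝ) :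
    P.toSiteChain.HasBoundedResponseAt T ↔
      ∀ μ : (N : ℕ) → ℝ → ℝ → Measure (PhaseSpace N),
        (∀ (N : ℕ) (T_L T_R : ℝ), 0 < T_L → 0 < T_R → P.IsSteadyState N T_L T_R (μ N T_L T_R)) →
          ∀ D : ℕ → ℝ,
            (∀ N : ℕ, Tendsto (fun δ : ℝ => P.totalCurrent (μ N (T + δ / 2) (T - δ / 2)) / δ)
              (𝓝[≠] 0) (𝓝 (D N))) →
            BddAbove (Set.range fun N => |D N|) :=
  Iff.rfl

/-- **Uniqueness makes the response quotient family-independent near `δ = 0`**: two admissible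
steady-state families agree at all positive bath temperatures, hence their difference quotients at `T`
agree once `T ± δ/2 > 0`, i.e. eventually along `𝓝[≠] 0`. -/
theorem response_quotient_eventuallyEq {P : OscillatorChain}
    (hU : ∀ (N : ℕ) (T_L T_R : ℝ), 0 < T_L → 0 < T_R → ∀ μ ν : Measure (PhaseSpace N),
      P.IsSteadyState N T_L T_R μ → P.IsSteadyState N T_L T_R ν → μ = ν)
    {μ₀ μ : (N : ℕ) → ℝ → ℝ → Measure (PhaseSpace N)}
    (hμ₀ : ∀ (N : ℕ) (T_L T_R : ℝ), 0 < T_L → 0 < T_R → P.IsSteadyState N T_L T_R (μ₀ N T_L T_R))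
    (hμ : ∀ (N : ℕ) (T_L T_R : ℝ), 0 < T_L → 0 < T_R → P.IsSteadyState N T_L T_R (μ N T_L T_R))
    {T : ℝ} (hT : 0 < T) (N : ℕ) :
    (fun δ : ℝ => P.totalCurrent (μ₀ N (T + δ / 2) (T - δ / 2)) / δ) =ᶠ[𝓝[≠] 0]
      (fun δ : ℝ => P.totalCurrent (μ N (T + δ / 2) (T - δ / 2)) / δ) := by
  have h2 : ∀ᶠ δ in 𝓝 (0 : ℝ), δ < 2 * T := eventually_lt_nhds (by linarith)
  have h2' : ∀ᶠ δ in 𝓝 (0 : ℝ), -(2 * T) < δ := eventually_gt_nhds (by linarith)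
  filter_upwards [mem_nhdsWithin_of_mem_nhds h2, mem_nhdsWithin_of_mem_nhds h2'] with δ hlt hgt
  have ha : 0 < T + δ / 2 := by linarith
  have hb : 0 < T - δ / 2 := by linarith
  rw [hU N _ _ ha hb _ _ (hμ₀ N _ _ ha hb) (hμ N _ _ ha hb)]

/-! ## Composition -/

/-- **Skeleton theorem — the crux `DiluteCellGaussianiser.DensificationClosure` BY NAME from the two stub
STATEMENTS** (sorry-free).  See the module docstring for the proof sketch. -/
theorem DensificationClosure_of :
    (∀ ω₂ lam β γ : ℝ, 0 < ω₂ → 0 < lam → 0 < β → 0 < γ → ∀ T : ℝ, 0 < T → ∀ d : ℕ,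
      (Literature.MathematicalPhysics.KineticTheory.HeatConduction.diluteChain ω₂ lam β γ d).HasBoundedResponseAt T →
        (Literature.MathematicalPhysics.KineticTheory.HeatConduction.diluteChain ω₂ lam β γ 1).HasBoundedResponseAt T) →
    (∀ ω₂ lam β γ : ℝ, 0 < ω₂ → 0 < lam → 0 < β → 0 < γ → (∀ (N : ℕ) (T_L T_R : ℝ), 0 < T_L → 0 < T_R → ∀ μ ν : MeasureTheory.Measure (Literature.MathematicalPhysics.KineticTheory.HeatConduction.PhaseSpace N), (Literature.MathematicalPhysics.KineticTheory.HeatConduction.pinnedChain ω₂ lam β γ).IsSteadyState N T_L T_R μ → (Literature.MathematicalPhysics.KineticTheory.HeatConduction.pinnedChain ω₂ lam β γ).IsSteadyState N T_L T_R ν → μ = ν) → ∀ μ : (N : ℕ) → ℝ → ℝ → MeasureTheory.Measure (Literature.MathematicalPhysics.KineticTheory.HeatConduction.PhaseSpace N), (∀ (N : ℕ) (T_L T_R : ℝ), 0 < T_L → 0 < T_R → (Literature.MathematicalPhysics.KineticTheory.HeatConduction.pinnedChain ω₂ lam β γ).IsSteadyState N T_L T_R (μ N T_L T_R)) → ∀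 T : ℝ, 0 < T → ∀ D : ℕ → ℝ, (∀ N : ℕ, Filter.Tendsto (fun δ : ℝ => (Literature.MathematicalPhysics.KineticTheory.HeatConduction.pinnedChain ω₂ lam β γ).totalCurrent (μ N (T + δ / 2) (T - δ / 2)) / δ) (nhdsWithin 0 {(0 : ℝ)}ᶜ) (nhds (D N))) → BddAbove (Set.range fun N => |D N|) → ∃ k : ℝ, 0 < k ∧ Filter.Tendsto D Filter.atTop (nhds k)) →
    _root_.Summit.AtomisticToContinuum.FouriersLaw.Theses.DiluteCellGaussianiser.DensificationClosure := by
  intro hDensify hConv ω₂ lam β γ hω hl hβ hγ T hT hdilute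
  obtain ⟨d₀, hd₀⟩ := hdilute
  -- (1) dilute law at `d₀` ⇒ bounded response of `C_{d₀}` (glue) ⇒ bounded response of `C_1` (stub 1)
  have hB1 : (diluteChain ω₂ lam β γ 1).HasBoundedResponseAt T :=
    hDensify ω₂ lam β γ hω hl hβ hγ T hT d₀ (hasBoundedResponseAt_of_fouriersLawAt (hd₀ d₀ le_rfl))
  -- (2) move everything to the conjunct's chain `pinnedChain ω₂ lam β γ`
  rw [diluteChain_one, toSiteChain_hasBoundedResponseAt_iff] at hB1
  rw [diluteChain_one_fouriersLawAt_iff, toSiteChain_fouriersLawAt_iff]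
  -- (3) weak-NESS uniqueness is landed (stmt-0741)
  have hU : ∀ (N : ℕ) (T_L T_R : ℝ), 0 < T_L → 0 < T_R →
      ∀ μ ν : Measure (PhaseSpace N), (pinnedChain ω₂ lam β γ).IsSteadyState N T_L T_R μ →
        (pinnedChain ω₂ lam β γ).IsSteadyState N T_L T_R ν → μ = ν :=
    _root_.Summit.AtomisticToContinuum.FouriersLaw.Theses.DiluteCellGaussianiser.NessUnique_holds
      ω₂ lam β γ hω hl hβ hγ
  -- (4) either a steady-state family exists, or the law is vacuous
  by_cases hfam : ∃ μ₀ : (N : ℕ) → ℝ → ℝ → Measure (PhaseSpace N),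
      ∀ (N : ℕ) (T_L T_R : ℝ), 0 < T_L → 0 < T_R →
        (pinnedChain ω₂ lam β γ).IsSteadyState N T_L T_R (μ₀ N T_L T_R)
  · obtain ⟨μ₀, hμ₀⟩ := hfam
    -- response limits along `μ₀` exist (landed, stmt-0717)
    have hex := _root_.Summit.AtomisticToContinuum.FouriersLaw.Theorems.FourierGreenKubo.finiteResponse_of_unique
      ω₂ lam β γ hω hl hβ hγ hU μ₀ hμ₀ T hT
    choose D₀ hD₀ using hex
    -- they are bounded (stub 1, via steps (1)-(2)) hence converge to some `k > 0` (stub 2)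
    have hbdd : BddAbove (Set.range fun N => |D₀ N|) := hB1 μ₀ hμ₀ D₀ hD₀
    obtain ⟨k, hk, hlim⟩ := hConv ω₂ lam β γ hω hl hβ hγ hU μ₀ hμ₀ T hT D₀ hD₀ hbdd
    -- every admissible family has the same response quotients near `δ = 0`, hence the same `D₀`
    refine ⟨k, hk, fun μ hμ => ⟨D₀, fun N => ?_, hlim⟩⟩
    exact (hD₀ N).congr' (response_quotient_eventuallyEq hU hμ₀ hμ hT N)
  · exact ⟨1, one_pos, fun μ hμ => (hfam ⟨μ, hμ⟩).elim⟩

/-- The crux from the two REGISTERED stubs (its only `sorry`s are those of `stub_densifyBounded` and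
`stub_boundedResponseConverges`). -/
theorem DensificationClosure_skeleton :
    _root_.Summit.AtomisticToContinuum.FouriersLaw.Theses.DiluteCellGaussianiser.DensificationClosure :=
  DensificationClosure_of stub_densifyBounded stub_boundedResponseConverges

end Birth

end Summit.AtomisticToContinuum.FouriersLaw.Cruxes.DensificationClosure

end
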